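import Literature.RepresentationTheory.GeneralLinear.SL2TripleCornerCommutant
import HarnessLib

/-!
# The commutant of a commuting PAIR of `𝔰𝔩₂`-triples in isotypic position: dimension `(rk P′P)²`, scalar centre

Family `hodge`, layer `Literature/RepresentationTheory/GeneralLinear`; THEOREMS ONLY (no definition, no named fact;
D-0026).  Pure linear algebra over a field `K`, NO Hodge theory imported; sequel of `SL2TripleCommutant` and
`SL2TripleCornerCommutant`, written for the cell `pub-hodgecm2` (COR-CM) lane MT-RANK-SEVEN-TYPEIII, seat `b27`, where it
is applied to `W = H¹(X, ℂ)` carrying the two commuting standard `sl₂`'s `𝔰 = ⟨E, F, 2P − 1⟩` and `𝔨 = ⟨e′, f′, h′⟩` of the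
type-III position (`Motives/HodgeLieWeightOnePlusLineCommutant`).  (Not to be confused with the tree's
`SL2TripleDoubleCommutant`, the bicommutant of ONE triple.)

SETTING.  `P, E, F, α` and `P′, E′, F′, α′` two `𝔰𝔩₂`-triples in isotypic position on `W` (`P² = P`, `P E = E`, `E P = 0`,
`P F = 0`, `F P = F`, `E F = α P`, `F E = α(1 − P)`, and the same primed), every primed operator commuting with every
unprimed one; `𝒟 ⊆ End W` the joint COMMUTANT of the six operators (hypothesis `h𝒟`).  Then `W ≅ W₁₁ ⊗ std ⊗ std′` with
`W₁₁ = range (P′P)`, and: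

* **`finrank_pairCommutant_eq_sq`** — `dim_K 𝒟 = (dim_K range (P′ P))²`.  PROOF: `T ↦ T P` is a linear isomorphism of `𝒟`
  onto the corner `D = {Q : PQ = Q = QP, Q commutes with P′, E′, F′}` (inverse `Q ↦ Q + α⁻¹ F Q E`, `SL2TripleCommutant`), and
  `D` is the corner at `P` of the commutant of the triple `(P′, E′P, F′P)`, which is in isotypic position on `range P`; so
  `dim D = (rk P′P)²` by `finrank_corner_commutant_eq_sq`.
* **`exists_eq_smul_one_of_mem_center_pairCommutant`** — an element of `𝒟` commuting with `𝒟` is a scalar (`P′P ≠ 0`).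

## References
* [FultonHarris1991] W. Fulton, J. Harris, *Representation Theory*, GTM 129 (1991), Lecture 11, §11.1; §6.1.
* [Humphreys1972] J. E. Humphreys, GTM 9 (1972), §6.1 (Schur's lemma), §7.2.
-/

namespace Literature.RepresentationTheory.GeneralLinear

universe u v

variable {K : Type u} [Field K] {W : Type v} [AddCommGroup W] [Module K W]

namespace SL2Triple

/-! ## §1 Submodules cut out by commutation and corner conditions -/

/-- The commutant of three operators is a `K`-subspace (existence of the submodule with the stated membership).
[cite: Humphreys1972, §6.1] -/
theorem exists_submodule_commutant₃ (A B C : Module.End K W) :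
    ∃ M : Submodule K (Module.End K W), ∀ T, T ∈ M ↔ T * A = A * T ∧ T * B = B * T ∧ T * C = C * T := by
  refine ⟨{ carrier := {T | T * A = A * T ∧ T * B = B * T ∧ T * C = C * T}
            add_mem' := ?_, zero_mem' := ?_, smul_mem' := ?_ }, fun T => Iff.rfl⟩
  · rintro a b ⟨h1, h2, h3⟩ ⟨h1', h2', h3'⟩
    exact ⟨by rw [add_mul, mul_add, h1, h1'], by rw [add_mul, mul_add, h2, h2'], by rw [add_mul, mul_add, h3, h3']⟩
  · exact ⟨by rw [zero_mul, mul_zero], by rw [zero_mul, mul_zero], by rw [zero_mul, mul_zero]⟩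
  · rintro c a ⟨h1, h2, h3⟩
    exact ⟨by rw [smul_mul_assoc, mul_smul_comm, h1], by rw [smul_mul_assoc, mul_smul_comm, h2],
      by rw [smul_mul_assoc, mul_smul_comm, h3]⟩

/-- The corner `{T ∈ M : T Q = T = Q T}` of a subspace `M ⊆ End W` at an operator `Q` is a `K`-subspace.
[cite: Humphreys1972, §6.1] -/
theorem exists_submodule_corner (M : Submodule K (Module.End K W)) (Q : Module.End K W) :
    ∃ D : Submodule K (Module.End K W), ∀ T, T ∈ D ↔ T ∈ M ∧ T * Q = T ∧ Q * T = T := by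
  refine ⟨{ carrier := {T | T ∈ M ∧ T * Q = T ∧ Q * T = T}
            add_mem' := ?_, zero_mem' := ?_, smul_mem' := ?_ }, fun T => Iff.rfl⟩
  · rintro a b ⟨h1, h2, h3⟩ ⟨h1', h2', h3'⟩
    exact ⟨M.add_mem h1 h1', by rw [add_mul, h2, h2'], by rw [mul_add, h3, h3']⟩
  · exact ⟨M.zero_mem, by rw [zero_mul], by rw [mul_zero]⟩
  · rintro c a ⟨h1, h2, h3⟩
    exact ⟨M.smul_mem c h1, by rw [smul_mul_assoc, h2], by rw [mul_smul_comm, h3]⟩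

/-! ## §2 The pair commutant is the corner `D`: dimension `(rk P′P)²` -/

section Pair

variable {P E F P' E' F' : Module.End K W} {α α' : K}

/-- **Corner elements at `P` commuting with `E′P`, `F′P` commute with `E′`, `F′`** (and conversely), when `E′, F′`
commute with `P`. [cite: Humphreys1972, §6.1] -/
theorem commute_of_corner_commute (hX'P : E' * P = P * E') {Q : Module.End K W} (hQP : Q * P = Q) (hPQ : P * Q = Q) :
    Q * (E' * P) = E' * P * Q ↔ Q * E' = E' * Q := by
  constructor
  · intro h
    calc Q * E' = Q * P * E' := by rw [hQP]
      _ = Q * (E' * P) := by rw [mul_assoc, ← hX'P]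
      _ = E' * P * Q := h
      _ = E' * Q := by rw [mul_assoc, hPQ]
  · intro h
    rw [← mul_assoc, h, mul_assoc, hQP, mul_assoc, hPQ]

/-- **`dim_K 𝒟 = (dim_K range (P′P))²`** for the joint commutant `𝒟` of two commuting `𝔰𝔩₂`-triples `(P, E, F; α)`,
`(P′, E′, F′; α′)` in isotypic position on `W` (`W ≅ W₁₁ ⊗ std ⊗ std′`, Schur): `T ↦ TP` identifies `𝒟` with the corner at
`P` of the commutant of `(P′, E′P, F′P)` — a triple in isotypic position on `range P` — whose dimension is `(rk P′P)²`
(`finrank_corner_commutant_eq_sq`). [cite: FultonHarris1991, Lecture 11 (§11.1)] [cite: Humphreys1972, §6.1 and §7.2] -/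
theorem finrank_pairCommutant_eq_sq [FiniteDimensional K W] (hα : α ≠ 0) (hPP : P * P = P) (hPE : P * E = E)
    (hEP : E * P = 0) (hPF : P * F = 0) (hFP : F * P = F) (hEF : E * F = α • P) (hFE : F * E = α • (1 - P))
    (hα' : α' ≠ 0) (hP'P' : P' * P' = P') (hP'E' : P' * E' = E') (hE'P' : E' * P' = 0) (hP'F' : P' * F' = 0)
    (hF'P' : F' * P' = F') (hE'F' : E' * F' = α' • P') (hF'E' : F' * E' = α' • (1 - P'))
    (hP'P : P' * P = P * P') (hP'E : P' * E = E * P') (hP'F : P' * F = F * P')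
    (hE'P : E' * P = P * E') (hE'E : E' * E = E * E') (hE'F : E' * F = F * E')
    (hF'P : F' * P = P * F') (hF'E : F' * E = E * F') (hF'F : F' * F = F * F')
    {𝒟 : Submodule K (Module.End K W)}
    (h𝒟 : ∀ T, T ∈ 𝒟 ↔ (T * P = P * T ∧ T * E = E * T ∧ T * F = F * T) ∧
      (T * P' = P' * T ∧ T * E' = E' * T ∧ T * F' = F' * T)) :
    Module.finrank K 𝒟 = Module.finrank K (LinearMap.range (P' * P)) ^ 2 := by
  obtain ⟨C, hC⟩ := exists_submodule_commutant₃ (K := K) P E F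
  obtain ⟨C', hC'⟩ := exists_submodule_commutant₃ (K := K) P' (E' * P) (F' * P)
  obtain ⟨D, hD⟩ := exists_submodule_corner C' P
  -- (a) the corner `D` of the commutant of `(P′, E′P, F′P)` at `P`
  have hDfin : Module.finrank K D = Module.finrank K (LinearMap.range (P' * P)) ^ 2 :=
    finrank_corner_commutant_eq_sq (P := P') (E := E' * P) (F := F' * P) (Q := P) hα' hPP hP'P hP'P'
      (by rw [← mul_assoc, hP'E']) (by rw [mul_assoc, ← hP'P, ← mul_assoc, hE'P', zero_mul])
      (by rw [← mul_assoc, hP'F', zero_mul]) (by rw [mul_assoc, ← hP'P, ← mul_assoc, hF'P'])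
      (by rw [mul_assoc, hPP]) (by rw [← mul_assoc, ← hE'P, mul_assoc, hPP]) (by rw [mul_assoc, hPP])
      (by rw [← mul_assoc, ← hF'P, mul_assoc, hPP])
      (by rw [mul_assoc, ← mul_assoc P F' P, ← hF'P, mul_assoc F' P P, hPP, ← mul_assoc, hE'F', smul_mul_assoc])
      (by rw [mul_assoc, ← mul_assoc P E' P, ← hE'P, mul_assoc E' P P, hPP, ← mul_assoc, hF'E', smul_mul_assoc, sub_mul,
        one_mul]) hC' hD
  -- (b) membership in `D` unpacked
  have hDmem : ∀ Q, Q ∈ D ↔ (Q * P' = P' * Q ∧ Q * E' = E' * Q ∧ Q * F' = F' * Q) ∧ Q * P = Q ∧ P * Q = Q := by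
    intro Q
    rw [hD, hC']
    constructor
    · rintro ⟨⟨h1, h2, h3⟩, hQP, hPQ⟩
      exact ⟨⟨h1, (commute_of_corner_commute hE'P hQP hPQ).1 h2, (commute_of_corner_commute hF'P hQP hPQ).1 h3⟩, hQP, hPQ⟩
    · rintro ⟨⟨h1, h2, h3⟩, hQP, hPQ⟩
      exact ⟨⟨h1, (commute_of_corner_commute hE'P hQP hPQ).2 h2, (commute_of_corner_commute hF'P hQP hPQ).2 h3⟩, hQP, hPQ⟩
  -- (c) `Q ↦ Q + α⁻¹ F Q E` maps `D` into `𝒟`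
  have hlift : ∀ X' : Module.End K W, X' * F = F * X' → X' * E = E * X' → ∀ Q : Module.End K W, Q * X' = X' * Q →
      (Q + α⁻¹ • (F * Q * E)) * X' = X' * (Q + α⁻¹ • (F * Q * E)) := by
    intro X' hX'F hX'E Q hQX'
    have h : F * Q * E * X' = X' * (F * Q * E) := by
      rw [mul_assoc (F * Q) E X', ← hX'E, ← mul_assoc (F * Q) X' E, mul_assoc F Q X', hQX', ← mul_assoc F X' Q, ← hX'F,
        mul_assoc X' F Q, mul_assoc X' (F * Q) E]
    rw [add_mul, mul_add, smul_mul_assoc, mul_smul_comm, hQX', h]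
  have hto : ∀ Q, Q ∈ D → Q + α⁻¹ • (F * Q * E) ∈ 𝒟 := by
    intro Q hQ
    obtain ⟨⟨h1, h2, h3⟩, hQP, hPQ⟩ := (hDmem Q).1 hQ
    exact (h𝒟 _).2 ⟨(hC _).1 (mem_commutant_of_corner hα hPE hEP hPF hFP hEF hC hPQ hQP),
      hlift P' hP'F hP'E Q h1, hlift E' hE'F hE'E Q h2, hlift F' hF'F hF'E Q h3⟩
  -- (d) `T ↦ T P` maps `𝒟` into `D`
  have hfrom : ∀ T, T ∈ 𝒟 → T * P ∈ D := by
    intro T hT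
    obtain ⟨⟨hTP, -, -⟩, hTP', hTE', hTF'⟩ := (h𝒟 T).1 hT
    refine (hDmem _).2 ⟨⟨?_, ?_, ?_⟩, by rw [mul_assoc, hPP], by rw [← mul_assoc, ← hTP, mul_assoc, hPP]⟩
    · rw [mul_assoc, ← hP'P, ← mul_assoc, hTP', mul_assoc]
    · rw [mul_assoc, ← hE'P, ← mul_assoc, hTE', mul_assoc]
    · rw [mul_assoc, ← hF'P, ← mul_assoc, hTF', mul_assoc]
  -- (e) the linear equivalence
  let Φ : D ≃ₗ[K] 𝒟 :=
    { toFun := fun Q => ⟨Q.1 + α⁻¹ • (F * Q.1 * E), hto Q.1 Q.2⟩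
      map_add' := fun a b => by
        apply Subtype.ext
        simp only [Submodule.coe_add, mul_add, add_mul, smul_add]
        abel
      map_smul' := fun c a => by
        apply Subtype.ext
        simp only [Submodule.coe_smul, RingHom.id_apply, mul_smul_comm, smul_mul_assoc, smul_add, smul_comm c α⁻¹]
      invFun := fun T => ⟨T.1 * P, hfrom T.1 T.2⟩
      left_inv := fun Q => by
        apply Subtype.ext
        obtain ⟨-, hQP, -⟩ := (hDmem Q.1).1 Q.2
        change (Q.1 + α⁻¹ • (F * Q.1 * E)) * P = Q.1
        rw [add_mul, hQP, smul_mul_assoc, mul_assoc (F * Q.1) E P, hEP, mul_zero, smul_zero, add_zero]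
      right_inv := fun T => by
        apply Subtype.ext
        obtain ⟨hTC, -⟩ := (h𝒟 T.1).1 T.2
        change T.1 * P + α⁻¹ • (F * (T.1 * P) * E) = T.1
        exact (eq_corner_add_of_mem_commutant hα hPE hFE hC ((hC _).2 hTC)).symm }
  rw [← Φ.finrank_eq, hDfin]

/-- **An element of the pair commutant `𝒟` commuting with `𝒟` is a scalar** (`P′P ≠ 0`): its corner `A = TP ∈ D` commutes with
`D` (test `T` against `Q + α⁻¹ F Q E ∈ 𝒟` and compress by `P`), hence `A = c P`
(`exists_eq_smul_of_mem_center_corner_commutant`), and `T = A + α⁻¹ F A E = c P + c (1 − P) = c · 1`.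
[cite: Humphreys1972, §6.1] [cite: FultonHarris1991, Lecture 11 (§11.1)] -/
theorem exists_eq_smul_one_of_mem_center_pairCommutant (hα : α ≠ 0) (hPP : P * P = P) (hPE : P * E = E)
    (hEP : E * P = 0) (hPF : P * F = 0) (hFP : F * P = F) (hEF : E * F = α • P) (hFE : F * E = α • (1 - P))
    (hα' : α' ≠ 0) (hP'P' : P' * P' = P') (hP'E' : P' * E' = E') (hE'P' : E' * P' = 0) (hP'F' : P' * F' = 0)
    (hF'P' : F' * P' = F') (hE'F' : E' * F' = α' • P') (hF'E' : F' * E' = α' • (1 - P'))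
    (hP'P : P' * P = P * P') (hP'E : P' * E = E * P') (hP'F : P' * F = F * P')
    (hE'P : E' * P = P * E') (hE'E : E' * E = E * E') (hE'F : E' * F = F * E')
    (hF'P : F' * P = P * F') (hF'E : F' * E = E * F') (hF'F : F' * F = F * F') (h0 : P' * P ≠ 0)
    {𝒟 : Submodule K (Module.End K W)}
    (h𝒟 : ∀ T, T ∈ 𝒟 ↔ (T * P = P * T ∧ T * E = E * T ∧ T * F = F * T) ∧
      (T * P' = P' * T ∧ T * E' = E' * T ∧ T * F' = F' * T))
    {T : Module.End K W} (hT : T ∈ 𝒟) (hcomm : ∀ T' ∈ 𝒟, T * T' = T' * T) : ∃ c : K, T = c • 1 := by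
  obtain ⟨C, hC⟩ := exists_submodule_commutant₃ (K := K) P E F
  obtain ⟨C', hC'⟩ := exists_submodule_commutant₃ (K := K) P' (E' * P) (F' * P)
  obtain ⟨D, hD⟩ := exists_submodule_corner C' P
  have hDmem : ∀ Q, Q ∈ D ↔ (Q * P' = P' * Q ∧ Q * E' = E' * Q ∧ Q * F' = F' * Q) ∧ Q * P = Q ∧ P * Q = Q := by
    intro Q
    rw [hD, hC']
    constructor
    · rintro ⟨⟨h1, h2, h3⟩, hQP, hPQ⟩
      exact ⟨⟨h1, (commute_of_corner_commute hE'P hQP hPQ).1 h2, (commute_of_corner_commute hF'P hQP hPQ).1 h3⟩, hQP, hPQ⟩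
    · rintro ⟨⟨h1, h2, h3⟩, hQP, hPQ⟩
      exact ⟨⟨h1, (commute_of_corner_commute hE'P hQP hPQ).2 h2, (commute_of_corner_commute hF'P hQP hPQ).2 h3⟩, hQP, hPQ⟩
  have hlift : ∀ X' : Module.End K W, X' * F = F * X' → X' * E = E * X' → ∀ Q : Module.End K W, Q * X' = X' * Q →
      (Q + α⁻¹ • (F * Q * E)) * X' = X' * (Q + α⁻¹ • (F * Q * E)) := by
    intro X' hX'F hX'E Q hQX'
    have h : F * Q * E * X' = X' * (F * Q * E) := by
      rw [mul_assoc (F * Q) E X', ← hX'E, ← mul_assoc (F * Q) X' E, mul_assoc F Q X', hQX', ← mul_assoc F X' Q, ← hX'F,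
        mul_assoc X' F Q, mul_assoc X' (F * Q) E]
    rw [add_mul, mul_add, smul_mul_assoc, mul_smul_comm, hQX', h]
  have hto : ∀ Q, Q ∈ D → Q + α⁻¹ • (F * Q * E) ∈ 𝒟 := by
    intro Q hQ
    obtain ⟨⟨h1, h2, h3⟩, hQP, hPQ⟩ := (hDmem Q).1 hQ
    exact (h𝒟 _).2 ⟨(hC _).1 (mem_commutant_of_corner hα hPE hEP hPF hFP hEF hC hPQ hQP),
      hlift P' hP'F hP'E Q h1, hlift E' hE'F hE'E Q h2, hlift F' hF'F hF'E Q h3⟩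
  obtain ⟨⟨hTP, hTE, hTF⟩, hTP', hTE', hTF'⟩ := (h𝒟 T).1 hT
  -- the corner `A = T P` of `T` lies in `D` and is central there
  have hA : T * P ∈ D := by
    refine (hDmem _).2 ⟨⟨?_, ?_, ?_⟩, by rw [mul_assoc, hPP], by rw [← mul_assoc, ← hTP, mul_assoc, hPP]⟩
    · rw [mul_assoc, ← hP'P, ← mul_assoc, hTP', mul_assoc]
    · rw [mul_assoc, ← hE'P, ← mul_assoc, hTE', mul_assoc]
    · rw [mul_assoc, ← hF'P, ← mul_assoc, hTF', mul_assoc]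
  have hAcomm : ∀ Q ∈ D, T * P * Q = Q * (T * P) := by
    intro Q hQ
    obtain ⟨-, hQP, hPQ⟩ := (hDmem Q).1 hQ
    have h := congrArg (fun Z => P * Z * P) (hcomm _ (hto Q hQ))
    simp only [mul_add, add_mul, mul_smul_comm, smul_mul_assoc] at h
    -- `P T Q P = T Q`, `P T F Q E P = 0`, `P Q T P = Q T`, `P F Q E T P = 0`
    have h1 : P * (T * Q) * P = T * Q := by rw [← mul_assoc, ← hTP, mul_assoc, mul_assoc, hQP, ← mul_assoc, mul_assoc T P Q, hPQ]
    have h2 : P * (T * (F * Q * E)) * P = 0 := by rw [mul_assoc, mul_assoc, mul_assoc, mul_assoc, hEP, mul_zero, mul_zero, mul_zero, mul_zero]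
    have h3 : P * (Q * T) * P = Q * T := by rw [← mul_assoc, hPQ, mul_assoc, hTP, ← mul_assoc, hQP]
    have h4 : P * (F * Q * E * T) * P = 0 := by rw [mul_assoc F Q E, mul_assoc F (Q * E) T, ← mul_assoc P F, hPF, zero_mul, zero_mul]
    rw [h1, h2, h3, h4, smul_zero, add_zero, add_zero] at h
    rw [mul_assoc, hPQ, h, ← mul_assoc, ← h, mul_assoc, hQP]
  obtain ⟨c, hc⟩ := exists_eq_smul_of_mem_center_corner_commutant (P := P') (E := E' * P) (F := F' * P) (Q := P) hα' hPP
    hP'P hP'P' (by rw [← mul_assoc, hP'E']) (by rw [mul_assoc, ← hP'P, ← mul_assoc, hE'P', zero_mul])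
    (by rw [← mul_assoc, hP'F', zero_mul]) (by rw [mul_assoc, ← hP'P, ← mul_assoc, hF'P'])
    (by rw [mul_assoc, hPP]) (by rw [← mul_assoc, ← hE'P, mul_assoc, hPP]) (by rw [mul_assoc, hPP])
    (by rw [← mul_assoc, ← hF'P, mul_assoc, hPP])
    (by rw [mul_assoc, ← mul_assoc P F' P, ← hF'P, mul_assoc F' P P, hPP, ← mul_assoc, hE'F', smul_mul_assoc])
    (by rw [mul_assoc, ← mul_assoc P E' P, ← hE'P, mul_assoc E' P P, hPP, ← mul_assoc, hF'E', smul_mul_assoc, sub_mul,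
      one_mul]) h0 hC' hD hA hAcomm
  refine ⟨c, ?_⟩
  rw [eq_corner_add_of_mem_commutant hα hPE hFE hC ((hC _).2 ⟨hTP, hTE, hTF⟩), hc, mul_smul_comm, smul_mul_assoc,
    mul_assoc F P E, hPE, hFE, smul_smul, smul_smul, mul_right_comm, inv_mul_cancel₀ hα, one_mul, ← smul_add,
    add_sub_cancel]

end Pair

end SL2Triple

end Literature.RepresentationTheory.GeneralLinear
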